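import Literature.AnabelianGeometry.AbsoluteAnabelian.MonoAnalyticLogShells
import Literature.NumberTheory.GaloisRepresentations.InducedGaloisRep
import HarnessLib

/-!
# [AbsTopIII] Def 5.6 (i): the morphisms of `TG⊢` (open injections of profinite groups) — the
# printed generating instances, kernel-checked (FACT-LIST F-2474, instance forms)

S. Mochizuki, *Topics in absolute anabelian geometry III: global reconstruction algorithms*,
J. Math. Sci. Univ. Tokyo 22 (2015) [MochizukiAbsTopIII2015]; manuscript pages (`paper:url-5493eb38cbb7`):
Def. 5.6 (i) p. 134 ("a category `TG⊢` whose objects are the profinite groups isomorphic to the absolute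
Galois group of an MLF and whose morphisms are open injections of profinite groups"), Def. 5.1 (iv) p. 116
(the same morphism class for `TG`).

PROOF-ONLY companion (no definition, no instance, no notation) of `MonoAnalyticLogShells.lean`
(abc-iut-L4-t3), abc-iut cell seat abc-iut-f-003 (FACT-LIST row **F-2474** `IsOpenInjection` (structure),
class `preparatory`, kernel_closedness `parametrised`; label «universal-closure REFUTED
(`not_forall_isOpenInjection`, p427521); instance forms PROVED»).  The instances in the tree so far are the
identity (`PanalocalGaloisTheater.isOpenInjection_id`), isomorphism-conjugates
(`GlobalAnabelianContext.isOpenInjection_comp_equiv`) and the decomposition-group restrictions of the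
generic model (`GlobalAnabelianContext.exists_isOpenInjection_decompGrp`).  This file adds the PRINTED
GENERATORS of the morphism class:

* `isOpenInjection_iff_isOpenEmbedding` — for a continuous homomorphism of profinite groups, "open
  injection" in the typed sense (injective with open image) is Mathlib's `IsOpenEmbedding` (compact source,
  Hausdorff target);
* `IsOpenInjection.comp` — `TG⊢` is closed under composition;
* `isOpenInjection_openSubgroup_subtype` — the inclusion of an open subgroup (cf. Prop. 5.8 (ii): open
  subgroups of objects of `TG⊢` are objects of `TG⊢`, `Prop58ii.OpenSubgroupIsMLFGaloisType_holds`);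
* `isOpenInjection_absGaloisRestrict` — for a finite extension `F/K` of fields of characteristic zero (in
  particular of MLF's), the restriction `G_F → G_K` is an open injection: THE morphisms of `TG⊢` of
  Def. 5.6 (i) (tree: `absGaloisRestrict_injective`, `isOpen_range_absGaloisRestrict`).

Classical; nothing here bears on [IUTchIII] Cor. 3.12 or takes a side; typed ≠ proved for the row itself,
which is a DEFINITION.
-/

namespace Literature.AnabelianGeometry.AbsoluteAnabelian

open _root_.Topology
open Literature.NumberTheory.GaloisRepresentations

universe u

/-! ## Open injections are the open embeddings -/

/-- A morphism of `TG⊢` (an injective continuous homomorphism of profinite groups with open image) is an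
open topological embedding: the source is compact and the target Hausdorff, so a continuous injection is a
closed embedding, and its image is open by hypothesis. [cite: MochizukiAbsTopIII2015, Def 5.6 (i) p. 134] -/
theorem IsOpenInjection.isOpenEmbedding {G H : ProfiniteGrp.{u}} {f : G →ₜ* H} (hf : IsOpenInjection f) :
    IsOpenEmbedding f :=
  ⟨(f.continuous.isClosedEmbedding hf.injective).isEmbedding, hf.isOpen_range⟩

/-- Conversely an open embedding is an open injection. [cite: MochizukiAbsTopIII2015, Def 5.6 (i) p. 134] -/
theorem IsOpenInjection.of_isOpenEmbedding {G H : ProfiniteGrp.{u}} {f : G →ₜ* H} (hf : IsOpenEmbedding f) :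
    IsOpenInjection f :=
  ⟨hf.injective, hf.isOpen_range⟩

/-- For continuous homomorphisms of profinite groups, "open injection" (Def. 5.6 (i)) ⟺ Mathlib's
`IsOpenEmbedding`. [cite: MochizukiAbsTopIII2015, Def 5.6 (i) p. 134] -/
theorem isOpenInjection_iff_isOpenEmbedding {G H : ProfiniteGrp.{u}} (f : G →ₜ* H) :
    IsOpenInjection f ↔ IsOpenEmbedding f :=
  ⟨IsOpenInjection.isOpenEmbedding, IsOpenInjection.of_isOpenEmbedding⟩

/-- An open injection is an open map (so it carries open subgroups to open subgroups).
[cite: MochizukiAbsTopIII2015, Def 5.6 (i) p. 134] -/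
theorem IsOpenInjection.isOpenMap {G H : ProfiniteGrp.{u}} {f : G →ₜ* H} (hf : IsOpenInjection f) :
    IsOpenMap f :=
  hf.isOpenEmbedding.isOpenMap

/-! ## `TG⊢` is closed under composition -/

/-- The composite of two open injections of profinite groups is an open injection (the morphisms of
Def. 5.6 (i) form a category). [cite: MochizukiAbsTopIII2015, Def 5.6 (i) p. 134] -/
theorem IsOpenInjection.comp {G H K : ProfiniteGrp.{u}} {g : H →ₜ* K} {f : G →ₜ* H}
    (hg : IsOpenInjection g) (hf : IsOpenInjection f) : IsOpenInjection (g.comp f) :=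
  IsOpenInjection.of_isOpenEmbedding (hg.isOpenEmbedding.comp hf.isOpenEmbedding)

/-! ## Open subgroups -/

/-- The inclusion of an open subgroup `U ≤ G` of a profinite group is an open injection (with Prop. 5.8 (ii),
`Prop58ii.OpenSubgroupIsMLFGaloisType_holds`: open subgroups of objects of `TG⊢` are again objects, via this
morphism). [cite: MochizukiAbsTopIII2015, Def 5.6 (i) p. 134] -/
theorem isOpenInjection_openSubgroup_subtype {G : ProfiniteGrp.{u}} (U : OpenSubgroup G) :
    IsOpenInjection (G := ProfiniteGrp.ofClosedSubgroup ⟨U.toSubgroup, U.isClosed⟩) (H := G)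
      { toMonoidHom := U.toSubgroup.subtype, continuous_toFun := continuous_subtype_val } := by
  refine ⟨Subtype.val_injective, ?_⟩
  change IsOpen (Set.range (Subtype.val : U.toSubgroup → G))
  rw [Subtype.range_coe_subtype]
  exact U.isOpen

/-! ## The printed generators: restriction along a finite extension of fields -/

/-- **Def. 5.6 (i) at its printed instance.**  For a finite extension `F/K` of fields of characteristic
zero — in particular of MLF's, where `G_K`, `G_F` are objects of `TG⊢`
(`isMLFGaloisType_absoluteGaloisGrp`, `IsMLFGaloisType.of_isMLF`) — the restriction homomorphism
`G_F = Gal(F̄/F) → Gal(K̄/K) = G_K` is an open injection of profinite groups, i.e. a morphism of `TG⊢`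
(injective because `F/K` is algebraic; open image `= G_{K}`-stabiliser of `F ⊆ K̄`, of index `[F : K]`).
[cite: MochizukiAbsTopIII2015, Def 5.6 (i) p. 134] -/
theorem isOpenInjection_absGaloisRestrict (K F : Type u) [Field K] [CharZero K] [Field F] [CharZero F]
    [Algebra K F] [FiniteDimensional K F] :
    IsOpenInjection (G := absoluteGaloisGrp F) (H := absoluteGaloisGrp K) (absGaloisRestrict K F) :=
  ⟨absGaloisRestrict_injective K F, isOpen_range_absGaloisRestrict K F⟩

/-- The same through the dictionary `isOpenInjection_iff_isOpenEmbedding`: it is the tree's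
`isOpenEmbedding_absGaloisRestrict`. [cite: MochizukiAbsTopIII2015, Def 5.6 (i) p. 134] -/
theorem isOpenInjection_absGaloisRestrict' (K F : Type u) [Field K] [CharZero K] [Field F] [CharZero F]
    [Algebra K F] [FiniteDimensional K F] :
    IsOpenInjection (G := absoluteGaloisGrp F) (H := absoluteGaloisGrp K) (absGaloisRestrict K F) :=
  IsOpenInjection.of_isOpenEmbedding (isOpenEmbedding_absGaloisRestrict K F)

/-- A tower `K ⊆ F ⊆ L` of finite extensions gives the composite morphism `G_L → G_F → G_K` of `TG⊢`.
[cite: MochizukiAbsTopIII2015, Def 5.6 (i) p. 134] -/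
theorem isOpenInjection_absGaloisRestrict_comp (K F L : Type u) [Field K] [CharZero K] [Field F]
    [CharZero F] [Field L] [CharZero L] [Algebra K F] [FiniteDimensional K F] [Algebra F L]
    [FiniteDimensional F L] :
    IsOpenInjection (G := absoluteGaloisGrp L) (H := absoluteGaloisGrp K)
      ((absGaloisRestrict K F).comp (absGaloisRestrict F L)) :=
  (isOpenInjection_absGaloisRestrict K F).comp (isOpenInjection_absGaloisRestrict F L)

end Literature.AnabelianGeometry.AbsoluteAnabelian
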